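import Mathlib
import Literature.Barriers.ValiantsHypothesis.PartialDerivativesDetPerm
import Literature.Barriers.ValiantsHypothesis.ShiftedPartialsMonotone
import Summits.ValiantsHypothesis.ValiantsHypothesis.Theorems.SummationBitsHomogeneousRung

/-!
# Crux `WordLengthQP` (stmt-ValiantsHypothesis-6623), line `Sketch` (eps-order-ladder) —
stub `stub_spRank_prodAffine_le`

The method of partial derivatives (Nisan–Wigderson 1996, §3) for ONE product gate: if
`ℓ₁, …, ℓ_m` are affine forms (total degree `≤ 1`), every `k`-th order iterated partial
derivative of `ℓ₁ ⋯ ℓ_m` is a linear combination of the `binom(m, k)` sub-products with `k`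
factors deleted (a partial derivative of an affine form is a constant), so the dimension of the
span of the `k`-th order partials — the tree's flattening rank `shiftedPartialsRank K k 0`
(`shiftedPartialsRank_zero_eq`, file `PartialDerivativesDetPerm.lean`) — is at most `binom(m, k)`.

Proof: the membership statement is the tree theorem
`Summit.ValiantsHypothesis.SummationBits.iterPDeriv_prod_mem_span` (file
`SummationBitsHomogeneousRung.lean`); for `k ≤ m` the dimension count is `finrank_range_le_card`
over the `(m - k)`-subsets of the factors (`Fintype.card_finset_len`, `Nat.choose_symm`); for
`m < k` every `k`-th order derivative of the product vanishes (`spRankProd_iterPDeriv_prod_eq_zero`: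
after `m` derivatives the product is a constant), so the span is `⊥` and both sides are `0`.

## References

* [NisanWigderson1996] N. Nisan, A. Wigderson, *Lower bounds on arithmetic circuits via partial
  derivatives*, Comput. Complexity 6 (1996) 217–234, §3.
-/

-- `Summit.ValiantsHypothesis.ValiantsHypothesis.…` is the tree's mandated single-conjunct layout
-- (Sub = Summit), so the duplicated namespace component is intended.
set_option linter.dupNamespace false

noncomputable section

open MvPolynomial

namespace Summit.ValiantsHypothesis.ValiantsHypothesis.Cruxes.WordLengthQP.EpsOrderLadder

open Literature.Barriers.ValiantsHypothesis Summit.ValiantsHypothesis.SummationBits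

/-- More than `#ι` partial derivatives kill a product of `#ι` affine forms: after `#ι` of them the
product has become a constant (`iterPDeriv_prod_mem_span` with no factor left). [folklore] -/
theorem spRankProd_iterPDeriv_prod_eq_zero {K : Type} [Field K] {σ ι : Type} [DecidableEq ι]
    [Fintype ι] (ℓ : ι → MvPolynomial σ K) (hℓ : ∀ j, (ℓ j).totalDegree ≤ 1) :
    ∀ l : List σ, Fintype.card ι < l.length → iterPDeriv l (∏ j, ℓ j) = 0
  | [], h => absurd h (Nat.not_lt_zero _)
  | v :: l, h => by
    rw [iterPDeriv_cons]
    rw [List.length_cons] at h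
    rcases (Nat.lt_succ_iff.1 h).eq_or_lt with hml | hml
    · -- exactly `#ι` derivatives: the result is a constant, killed by `∂_v`
      have hmem := iterPDeriv_prod_mem_span ℓ hℓ l
      have h1 : (Set.range fun T : {T : Finset ι // T.card = Fintype.card ι - l.length} =>
          ∏ j ∈ T.1, ℓ j) ⊆ {1} := by
        rintro _ ⟨T, rfl⟩
        have hT : T.1 = ∅ := Finset.card_eq_zero.1 (by rw [T.2, hml, Nat.sub_self])
        show ∏ j ∈ T.1, ℓ j ∈ ({1} : Set (MvPolynomial σ K))
        rw [hT, Finset.prod_empty]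
        exact Set.mem_singleton 1
      obtain ⟨a, ha⟩ := Submodule.mem_span_singleton.1 (Submodule.span_mono h1 hmem)
      rw [← ha, Derivation.map_smul, pderiv_one, smul_zero]
    · rw [spRankProd_iterPDeriv_prod_eq_zero ℓ hℓ l hml, map_zero]

/-- The dimension count for a `Fintype`-indexed product of affine forms: the `k`-th order partials
of `∏ j, ℓ j` span at most `binom(#ι, k)` dimensions. [cite: NisanWigderson1996, §3] [folklore] -/
theorem spRankProd_finrank_span_derivSet_prod_le {K : Type} [Field K] {σ ι : Type} [DecidableEq ι]
    [Fintype ι] (ℓ : ι → MvPolynomial σ K) (hℓ : ∀ j, (ℓ j).totalDegree ≤ 1) (k : ℕ) :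
    Module.finrank K (Submodule.span K (derivSet k (∏ j, ℓ j))) ≤ (Fintype.card ι).choose k := by
  by_cases hk : k ≤ Fintype.card ι
  · -- the `binom(#ι, #ι - k)` sub-products `∏_{j ∈ T} ℓ j`, `#T = #ι - k`
    let b : {T : Finset ι // T.card = Fintype.card ι - k} → MvPolynomial σ K :=
      fun T => ∏ j ∈ T.1, ℓ j
    have hle : Submodule.span K (derivSet k (∏ j, ℓ j)) ≤ Submodule.span K (Set.range b) := by
      rw [Submodule.span_le]
      rintro _ ⟨l, hl, rfl⟩
      refine Submodule.span_mono ?_ (iterPDeriv_prod_mem_span ℓ hℓ l)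
      rintro _ ⟨T, rfl⟩
      exact ⟨⟨T.1, by rw [T.2, hl]⟩, rfl⟩
    haveI : Module.Finite K (Submodule.span K (Set.range b)) :=
      Module.Finite.span_of_finite K (Set.finite_range b)
    calc Module.finrank K (Submodule.span K (derivSet k (∏ j, ℓ j)))
        ≤ Module.finrank K (Submodule.span K (Set.range b)) := Submodule.finrank_mono hle
      _ ≤ Fintype.card {T : Finset ι // T.card = Fintype.card ι - k} := finrank_range_le_card b
      _ = (Fintype.card ι).choose k := by rw [Fintype.card_finset_len, Nat.choose_symm hk]
  · -- more derivatives than factors: every derivative vanishes, both sides are `0`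
    rw [not_le] at hk
    have hbot : Submodule.span K (derivSet k (∏ j, ℓ j)) = ⊥ := by
      rw [Submodule.span_eq_bot]
      rintro _ ⟨l, hl, rfl⟩
      exact spRankProd_iterPDeriv_prod_eq_zero ℓ hℓ l (hl ▸ hk)
    rw [hbot, finrank_bot]
    exact Nat.zero_le _

/-- **stub_spRank_prodAffine_le** (method of partial derivatives for one product gate): the
`k`-th order partials of a product of `m` affine forms lie in the span of its `binom(m, k)`
sub-products with `k` factors deleted, so the flattening rank `shiftedPartialsRank K k 0` of the
product is `≤ binom(m, k)`. [cite: NisanWigderson1996, §3] [folklore] -/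
theorem stub_spRank_prodAffine_le {K : Type} [Field K] {σ : Type} [Fintype σ] [DecidableEq σ]
    (ls : List (MvPolynomial σ K)) (hls : ∀ ℓ ∈ ls, ℓ.totalDegree ≤ 1) (k : ℕ) :
    Literature.Barriers.ValiantsHypothesis.shiftedPartialsRank K k 0 ls.prod ≤ ls.length.choose k := by
  rw [shiftedPartialsRank_zero_eq, ← Fin.prod_univ_getElem ls]
  have h := spRankProd_finrank_span_derivSet_prod_le (fun i : Fin ls.length => ls[i.1])
    (fun i => hls _ (List.getElem_mem i.2)) k
  rwa [Fintype.card_fin] at h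

end Summit.ValiantsHypothesis.ValiantsHypothesis.Cruxes.WordLengthQP.EpsOrderLadder

end
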